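import Literature.MathematicalPhysics.QuantumFieldTheory.Balaban1983to89.B9Thm33SourceWitnessZdPer
import Literature.MathematicalPhysics.QuantumFieldTheory.Balaban1983to89.B9SupplySockB9P3ZdGammaUnivInAk
import Literature.MathematicalPhysics.QuantumFieldTheory.Balaban1983to89.B8LanF146

/-!
# `Balaban1983to89.B9SupplySockH59ZdSrcPer` — THE PERIODIC `SH59src` SOCKET OF THEOREM 4 ∕ THEOREM 8's CORE (dag-n05-c T5
# `B8Thm4CoreZdGF3HP2PerLanEGamma.thm4Core_zdGF3HP₂Per_map_lanE_γ'`, binder `SH59src` :150–:173) SUPPLIED FROM THE PERIODIC BINDERS AT EVERY TRUNCATION: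
# the (1.57)–(1.58)-with-source lines 1–2 at `Φ := (Site d → 𝔸)`, `Adm := «((source in (1.138) ∧ Hermitian ∧ supported ∧ bounded) ∧ periodic) ∧ |φ|₍₋₂₎ < γ(α₀+α₁)»`,
# `LanF := LanF146` — for any record with the binders, for the genuine torus record `opsAllZdPer`, at print's class `towerBondsP` (T5's text LITERALLY), and
# FULLY FED at the torus member (all truncations `m ≤ k` with ONE constant set)

statement-level skeleton of published theorems with citation tags; proofs where landed; nothing here is a claim about the
Yang–Mills mass gap

`[Balaban1985RegularSpaces]` ("B8", CMP **98**) Thm 4 p. 88 ∕ Thm 8 + (1.146) p. 101, (1.57)–(1.59) p. 86, (1.31) p. 82, p. 92, p. 77 *«Ω_j = T_η»*.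
`[Balaban1985BackgroundPropagators]` ("B9", CMP **99**) Thm 3.3 p. 399, (3.42) p. 397, (3.43)–(3.47) p. 398, (3.20)–(3.27) pp. 394–395, Thm 3.11 p. 416.
`[Balaban1984PropagatorsII]` (2.3) p. 224.  PDF held: `paper:balaban1985-cmp99-background-propagators` pp. 394–399.

CITATION HEADER (lean-in-tree rule).  Cell `pub-ymgap` (YM Track A), DAG node N06 = [B9], seat `pub-ymgap-dag-n06-b` (g24), the (β′-PERIODIC) road.  TRIGGER: dag-n05-c
g17 I.42020 «two NEW periodic socket texts will want suppliers — `SB9srcH2Per` … and `SH59src` with periodic source (T5 :150–:173); both = your ℤᵈ texts + periodicity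
guards».  The first is this seat's FILE 5 ∕ FILE 6 (`B9SupplySockB9P3ZdSrcPer`, `B9Thm33SourceWitnessZdPer`); THIS FILE is the second: the periodic twin of
`B9SupplySockB9P3ZdGammaUnivInAk.sockH59srcPI_univ_explicit_on_lin` in the frame-free style — T5's binder `SH59src` is generic in a source type `Φ`, an
admissibility predicate `Adm a φ U₀ α₀ α₁` and a gauge predicate `LanF a U₀ φ m W`; it is supplied here at `Φ := Site d → 𝔸`,
`Adm a φ U₀ α₀ α₁ := (((InR138 … U₀ φ ∧ (∀ x, IsSelfAdjoint (φ x)) ∧ (∀ x ∉ Ω₀, φ x = 0) ∧ Bdd … φ) ∧ IsPeriodic (p a) φ) ∧ |φ|₍₋₂₎ < γ(α₀ + α₁))` (the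
consumers' source admissibility, conjunct order EXACT = dag-n05-c T6c `B8Thm8SurvivingZdGF3HP2PerMapLanEGammaGuarded` :109–:111 ∕ (9′) — n05-c SHAPE WORD I.42640) and `LanF a U₀ φ m W := LanF146 L (ι a).k (ι a).η ((ι a).Ω 0) (ι a).Λs U₀ φ m W` (dag-n05-d's (1.146) gauge
predicate).  PROOF = the `ℤᵈ` supplier's token for token on FILE 5's `sockSrc_core_at_univ_per`: the exponent `A′` of `W` has size
`K₀(α₀+α₁)·(Lʲη)⁻¹`, `K₀ = 2L(5dLB₈) + 8·8B₀″(5dLB₈)`, so the threshold is `α₀ + α₁ ≤ min{c_P, c_P∕K₀}`; the Landau relation for `A′` from `LanF146` by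
`logCfg_eq_of_univ` + `mulClause_congr`; lines 1–2 of the core with the source allowance `2c_S|φ|₍₋₂₎ ≤ γ″B₀′(α₀+α₁)`.  Nothing is re-declared.

WHAT IS PROVED (kernel, 0 sorry; no `def`, no `instance`, no `notation`).
* §1 ★★★ `sockH59srcPer_of_binders` (THE FAMILY BODY OF T5's `SH59src` ∀ `a : J` at `(Φ, Adm, LanF)` as above, class map `ΛbP a m`: from the periodic binders at
  EVERY truncation `m ≤ (ι a).k` — `InvAtHIPer aI`, `CurvAtInAk c₆₉`, `AvgAtP q (ΛbP a)`, `GlobAtIPer aT B₀`, `HolderAtIH2Per aT C_β β len`, `PerAtU`, `PerDRDsAt`,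
  `GopAddAt`, `SrcAtIPer aS c_S`, `SrcHolderAtIH2Per aS c_Sβ` — with `B₀ ↦ max{1, 2B₀max{1,q}}`, `γ′ ↦ 2c_Sγ∕B₀′`, `cP ↦ min{c_P, c_P∕K₀}`,
  `c_P = min{1∕16, aI, aT, aS, 1∕(2B₀c₆₉M+1)}`).
* §2 ★★★ `sockH59srcPer_opsAllZdPer_of_binders` (the genuine torus record: `CurvAtInAk` (c₆₉ = 14(d−1)), `AvgAtP` (q = qQ, EDITION P₀ law at every truncation),
  `PerAtU` (`Lᵏ ∣ p a`), `PerDRDsAt`, `GopAddAt` DISCHARGED; displayed ∀ `m ≤ k`: `InvAtHIPer`, `GlobAtIPer`, `HolderAtIH2Per`, `SrcAtIPer`, `SrcHolderAtIH2Per`),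
  ★★★ `sockH59srcPer_opsAllZdPer_towerBondsP` (print's class: T5's `SH59src` text LITERALLY, `|B₁|` over `towerBondsP L (ι a).Ω ((ι a).Λs m) p.1`).
* §3 ★★★★ `srcBinders_opsAllZdPer_torusIdx_exists` ∕ `srcBinders_opsAllZdPer_torusIdx_allLevels` (at the torus member: ONE constant set `(aI, aT, B₀, C_β, c_S, c_Sβ)`
  for the five analytic binders at ALL truncations `m ≤ K`, `Lᴷ ∣ P` — FILE 6's binders + the `…_anti` monotonicity, induction on `K`),
  ★★★★★ `sockH59srcPer_genuine_torusIdx` (T5's `SH59src` text for the genuine record at the torus member, FULLY FED — NO binder of Bałaban's left).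

HONEST SCOPE.  (i) Supplier ∕ packaging over FILE 5–6: NO estimate of [B9] beyond those files' finite-dimensional linear algebra; constants per torus and, after
§3's `max ∕ min` over `K+1` truncations, `(t, P, τ, K)`-dependent (WATCH-QUAL-SOCKET-TORUS).  (ii) The admissibility `Adm` CONTAINS the periodicity of the source
`φ` (the consumers' T6c ∕ (9′) shape) — a consumer whose `Adm` does not is not served by this file.  (iii) Count-neutral; N05 ∕ N06 NOT discharged; K1⁹ `stmt-QuantumFields-27364` NOT closed; one
finite `𝕋⁴` programme at fixed `ε`, Bałaban as printed; R4 closes only the conditional finite-`𝕋⁴` rung `BalabanLadder.UV` — nothing continuum ∕ ℝ⁴ ∕ OS ∕ mass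
gap ∕ Clay.  Unit `pub-ymgap-dag-n06-b` (g24), 2026-08-28.
-/

noncomputable section

namespace Literature.MathematicalPhysics.QuantumFieldTheory.Balaban1983to89.B9SupplySockH59ZdSrcPer

open B7Prop1Explicit B7Prop2Explicit B7Eq92Concrete
open B7Prop1Local (InBox loK bondHiK)
open B7Prop4GeneralLevels (linCovIter)
open B8Ineq132 (covDerivFwd covDeriv InAk BondTouches)
open B8Eq119TwistedAxial (Restr129 InAx)
open B8Eq184Proof (cfgExp)
open B8Lemma1NonAbelian (mulCfg)
open B8Eq140Level (SideTouches)
open B8Eq146AExpansion (iEta plaqCovDeriv)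
open B8Eq155JBound (Jcur wsup)
open B8ScaledSupNorm (bondNorm msup weight Bdd)
open B8Ineq130 (tlo thi)
open B8Eq138LandauZd (IsLandau138 InR138 covLap covDivB QT logCfg)
open B8LanF146 (LanF146)
open B8Prop3GaugeFixedKLevel (mem_unitaryUnits_of_mgauge_eq)
open B8LeafModelZd (ZdIdx)
open B9Eq340HolderZd (hquot AdmPair)
open B9SupplySockB9P3ZdLetters (OpsZd)
open B9SupplySockB9P3ZdAt (GopAddAt)
open B9SupplySockB9P3ZdGammaInAk (CurvAtInAk)
open B9SupplySockB9P3ZdGammaUniv (AvgAtP)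
open B9Eq316AveragingTransposeZd (betaTau qQ)
open B9Eq316AveragingTransposeZdLevelZero (LevelSepPP0)
open B9Eq327GreenZdHermPer (InvAtHIPer invAtHIPer_anti)
open B9SupplySockB9P3ZdPer (GlobAtIPer PerAtU perAtU_opsAllZdPer avgAtP_opsAllZdPer₀ curvAtInAk_opsAllZdPer globAtIPer_anti)
open B9SupplySockB9P3ZdH2Per (HolderAtIH2Per holderAtIH2Per_anti)
open B9SupplySockB9P3ZdAllLettersZdPer (opsAllZdPer gopAddAt_opsAllZdPer)
open B9SupplySockB9P3ZdSrcPer (SrcAtIPer SrcHolderAtIH2Per PerDRDsAt sockSrc_core_at_univ_per perDRDsAt_opsAllZdPer srcAtIPer_anti srcHolderAtIH2Per_anti)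
open B9Thm33SourceWitnessZdPer (srcBinders_opsAllZdPer_torusIdx)
open B8Thm4TorusAt (torusLam)
open B8Thm2TorusMember (TorusMember torusIdx torusLamb mem_torusLamb_iff)
open B8TowerBondsPrinted (towerBondsP)
open T4TermwiseTorus (IsPeriodic)

-- `Site` alone could resolve to the torus sites of `Setup.lean`; re-export the `ℤ^d` sites of `B7Prop1Explicit`.
export B7Prop1Explicit (Site)

variable {d : ℕ} {𝔸 : Type*} [CStarAlgebra 𝔸]

/-! ## §1  The family body of T5's `SH59src` from the periodic binders at every truncation -/

section Family

variable [Nontrivial 𝔸] (L : ℕ)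

set_option maxHeartbeats 400000 in
/-- ★★★ **THE BODY OF T5's PERIODIC SOURCED SOCKET `SH59src` FROM THE PERIODIC BINDERS AT EVERY TRUNCATION, ∀ `a : J`** — at `Φ := Site d → 𝔸`, the periodic
admissibility and `LanF146` (module docstring); binders at every `m ≤ (ι a).k`; `2 ≤ d`, `1 ≤ L`, `1 ≤ M`, `B₈ > 0`, `B₀″ ≥ 0`.  Conclusion: T5's hypothesis text
with `cP := min{c_P, c_P∕K₀}`, `B₀ := max{1, 2B₀max{1,q}}`, `γ′ := 2c_Sγ∕B₀′`, `B₀′ := B₀″`, class `ΛbP a m`.  Proof: the `ℤᵈ` supplier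
`B9SupplySockB9P3ZdGammaUnivInAk.sockH59srcPI_univ_explicit_on_lin` token for token on FILE 5's `sockSrc_core_at_univ_per`.
[cite: Balaban1985RegularSpaces, Thm 4 p.88, Thm 8 + (1.146) p.101, (1.57)–(1.59) p.86, (1.31) p.82, p.92, p.77 («Ω_j = T_η»); Balaban1985BackgroundPropagators, Thm 3.3 p.399, (3.42) p.397, (3.43)–(3.47) p.398, (3.27) p.395; Balaban1984PropagatorsII, (2.3) p.224] -/
theorem sockH59srcPer_of_binders (hd2 : 2 ≤ d) (hL : 1 ≤ L) {c69 q aI aT aS B₀ Cβ β cS cSβ : ℝ} {len : Site d → ℝ}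
    {M : ℝ} (hM1 : 1 ≤ M) {J : Type*} (ι : J → ZdIdx d L) (p : J → ℕ) (hp : ∀ a, NeZero (p a)) (hΩJ : ∀ a, (ι a).Ω 0 = Set.univ)
    (ops : J → ℝ → ZdIdx d L → ℕ → OpsZd d 𝔸) (ΛbP : J → ℕ → ℕ → Set (Site d × Fin d))
    (hinv : ∀ a m, m ≤ (ι a).k → InvAtHIPer (p a) L (ops a) aI M (ι a) m) (hcurv : ∀ a m, m ≤ (ι a).k → CurvAtInAk L (ops a) c69 M (ι a) m)
    (havg : ∀ a m, m ≤ (ι a).k → AvgAtP L (ops a) q (ΛbP a) M (ι a) m) (hglob : ∀ a m, m ≤ (ι a).k → GlobAtIPer (p a) L (ops a) aT B₀ M (ι a) m)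
    (hhol : ∀ a m, m ≤ (ι a).k → HolderAtIH2Per (p a) L (ops a) aT Cβ β len M (ι a) m) (hper : ∀ a m, m ≤ (ι a).k → PerAtU (p a) L (ops a) M (ι a) m)
    (hDRDs : ∀ a m, m ≤ (ι a).k → PerDRDsAt (p a) L (ops a) M (ι a) m) (hadd : ∀ a m, m ≤ (ι a).k → GopAddAt L (ops a) M (ι a) m)
    (hsrc : ∀ a m, m ≤ (ι a).k → SrcAtIPer (p a) L (ops a) aS cS M (ι a) m)
    (hsrcH : ∀ a m, m ≤ (ι a).k → SrcHolderAtIH2Per (p a) L (ops a) aS cSβ β len M (ι a) m)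
    (hc69 : 0 ≤ c69) (hq : 0 ≤ q) (hB₀ : 0 < B₀) (hcS : 0 ≤ cS) (hcSβ : 0 ≤ cSβ) (γ : ℝ) {B₈ B₀'' : ℝ} (hB₈ : 0 < B₈) (hB₀'' : 0 ≤ B₀'') :
    ∀ a : J, ∀ α₀ α₁ : ℝ, 0 < α₀ → 0 < α₁ → α₀ + α₁ ≤ min (min (1 / 16) (min aI (min aT (min aS (1 / (2 * B₀ * c69 * M + 1)))))) ((min (1 / 16) (min aI (min aT (min aS (1 / (2 * B₀ * c69 * M + 1)))))) / (2 * (L * (5 * (d : ℝ) * L * B₈)) + 8 * (8 * B₀'' * (5 * (d : ℝ) * L * B₈)))) →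
      ∀ U₀ U' : Site d → Fin d → 𝔸ˣ, (∀ x κ, U₀ x κ ∈ unitaryUnits 𝔸) → (∀ x κ, U' x κ ∈ unitaryUnits 𝔸) →
      IsPeriodic (p a) U₀ → IsPeriodic (p a) U' → ∀ φ : Site d → 𝔸, (((InR138 L (ι a).k (ι a).η ((ι a).Ω 0) ((ι a).Λs (ι a).k) U₀ φ ∧ (∀ x, IsSelfAdjoint (φ x)) ∧ (∀ x, x ∉ (ι a).Ω 0 → φ x = 0) ∧
          Bdd L (ι a).k (ι a).η (-(2 : ℝ)) (fun j (x : Site d) => x ∈ (ι a).Ω j) φ) ∧ IsPeriodic (p a) φ) ∧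
        msup L (ι a).k (ι a).η (-(2 : ℝ)) (fun j (x : Site d) => x ∈ (ι a).Ω j) φ < γ * (α₀ + α₁)) →
      InAk L (ι a).k (ι a).η α₀ (ι a).Ω U₀ → InAk L (ι a).k (ι a).η α₀ (ι a).Ω (mulCfg U' U₀) → (∀ m, m ≤ (ι a).k → InAx L m ((ι a).Λs m) U₀ (mulCfg U' U₀)) →
      (∀ j, j ≤ (ι a).k → ∀ (z : Site d) (μ : Fin d),
        ((∀ x, InBox (tlo L z j) (thi L z j) x → x ∈ (ι a).Ω j) ∨ (∀ x, InBox (tlo L (z + e μ) j) (thi L (z + e μ) j) x → x ∈ (ι a).Ω j)) →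
        ‖(avgIter L (mulCfg U' U₀) j z μ : 𝔸) - (avgIter L U₀ j z μ : 𝔸)‖ ≤ α₁) →
      (∀ b ∈ {b : Site d × Fin d | SideTouches ((ι a).Ω 0) b.1 b.2}, ‖((U' b.1 b.2 : 𝔸ˣ) : 𝔸) - 1‖ ≤ α₁) →
      (∀ m, 1 ≤ m → m ≤ (ι a).k → ∀ (u : Site d → 𝔸ˣ) (W : Site d → Fin d → 𝔸ˣ) (A' : Site d → Fin d → 𝔸),
        (∀ x, u x ∈ unitaryUnits 𝔸) → IsPeriodic (p a) u → IsPeriodic (p a) W → IsPeriodic (p a) A' →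
        mgauge U₀ u W = U' → Restr129 L m ((ι a).Λs m) U₀ u → LanF146 L (ι a).k (ι a).η ((ι a).Ω 0) (ι a).Λs U₀ φ m W →
        (∀ y τ, IsSelfAdjoint (A' y τ)) →
        (∀ j, j ≤ m → ∀ y τ, SideTouches ((ι a).Ω j) y τ →
        W y τ = cfgExp (ι a).η A' y τ ∧ ‖A' y τ‖ ≤ (2 * (L * (5 * (d : ℝ) * L * B₈ * (α₀ + α₁))) + 8 * (8 * B₀'' * (5 * (d : ℝ) * L * B₈) * (α₀ + α₁))) * ((L : ℝ) ^ j * (ι a).η)⁻¹) →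
        (∀ y τ, (∀ j, j ≤ m → ¬ SideTouches ((ι a).Ω j) y τ) → A' y τ = 0) →
        msup L m (ι a).η (-(1 : ℝ)) (fun j (b : Site d × Fin d) => SideTouches ((ι a).Ω j) b.1 b.2) (fun b => A' b.1 b.2)
        ≤ max 1 (2 * B₀ * max 1 q) * (bondNorm L m (ι a).η (-(3 : ℝ)) (ι a).Ω (fun x μ => Jcur (ι a).η U₀ A' μ x)
        + wsup 1 (fun p : {p : ℕ × (Site d × Fin d) // p.1 ≤ m ∧ p.2 ∈ ΛbP a m p.1} =>
        linCovIter L U₀ (iEta (ι a).η A') p.1.1 p.1.2.1 p.1.2.2)) + (2 * cS * γ / max 1 (2 * B₀ * max 1 q)) * max 1 (2 * B₀ * max 1 q) * (α₀ + α₁) ∧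
        msup L m (ι a).η (-(2 : ℝ)) (fun j (t : Fin d × Fin d × Site d) => SideTouches ((ι a).Ω j) t.2.2 t.2.1)
        (fun t => covDerivFwd (ι a).η U₀ t.1 (fun z => A' z t.2.1) t.2.2)
        ≤ max 1 (2 * B₀ * max 1 q) * (bondNorm L m (ι a).η (-(3 : ℝ)) (ι a).Ω (fun x μ => Jcur (ι a).η U₀ A' μ x)
        + wsup 1 (fun p : {p : ℕ × (Site d × Fin d) // p.1 ≤ m ∧ p.2 ∈ ΛbP a m p.1} =>
        linCovIter L U₀ (iEta (ι a).η A') p.1.1 p.1.2.1 p.1.2.2)) + (2 * cS * γ / max 1 (2 * B₀ * max 1 q)) * max 1 (2 * B₀ * max 1 q) * (α₀ + α₁)) := by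
  have hM0 : 0 < M := lt_of_lt_of_le one_pos hM1
  have hL' : (1 : ℝ) ≤ L := by exact_mod_cast hL
  have hd' : (1 : ℝ) ≤ d := by exact_mod_cast (le_trans (by norm_num) hd2 : 1 ≤ d)
  obtain ⟨B', hB'_def⟩ : ∃ B' : ℝ, B' = max 1 (2 * B₀ * max 1 q) := ⟨_, rfl⟩
  have hB'1 : 1 ≤ B' := by rw [hB'_def]; exact le_max_left _ _
  have hB'0 : 0 < B' := lt_of_lt_of_le one_pos hB'1
  obtain ⟨cP, hcP_def⟩ : ∃ cP : ℝ, cP = min (1 / 16) (min aI (min aT (min aS (1 / (2 * B₀ * c69 * M + 1))))) := ⟨_, rfl⟩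
  set K₀ : ℝ := (2 * (L * (5 * (d : ℝ) * L * B₈)) + 8 * (8 * B₀'' * (5 * (d : ℝ) * L * B₈))) with hK₀_def
  have hK₀ : 0 < K₀ := by
    have h1 : 0 < 2 * (L * (5 * (d : ℝ) * L * B₈)) := by positivity
    have h2 : 0 ≤ 8 * (8 * B₀'' * (5 * (d : ℝ) * L * B₈)) := by positivity
    linarith
  rw [← hB'_def, ← hcP_def]
  intro a α₀ α₁ hα₀ hα₁ hs U₀ U' hU₀ hU' hU₀p _ φ hφ hInA _ _ _ _ m _ hmk u W A' hu _ _ hA'p hW _ hLanF hsa h41 hA0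
  obtain ⟨⟨⟨-, hφs, -, hφB⟩, hφp⟩, hφF⟩ := hφ
  haveI := hp a
  have hη : 0 < (ι a).η := (ι a).hη
  -- the smallness constant of the datum and the guard of the level-`m` socket
  set K : ℝ := 2 * (L * (5 * (d : ℝ) * L * B₈ * (α₀ + α₁))) + 8 * (8 * B₀'' * (5 * (d : ℝ) * L * B₈) * (α₀ + α₁)) with hK_def
  have hKK₀ : K = K₀ * (α₀ + α₁) := by rw [hK_def, hK₀_def]; ring
  have hS0 : 0 < α₀ + α₁ := add_pos hα₀ hα₁
  have hKpos : 0 < K := by rw [hKK₀]; exact mul_pos hK₀ hS0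
  have hα₀P : α₀ ≤ cP := by linarith only [hα₁, hs, min_le_left cP (cP / K₀)]
  have hKP : K ≤ cP := by
    have h1 : α₀ + α₁ ≤ cP / K₀ := hs.trans (min_le_right _ _)
    calc K = K₀ * (α₀ + α₁) := hKK₀
      _ ≤ K₀ * (cP / K₀) := mul_le_mul_of_nonneg_left h1 hK₀.le
      _ = cP := by field_simp
  have hK16 : K ≤ 1 / 16 := hKP.trans (by rw [hcP_def]; exact min_le_left _ _)
  rw [hcP_def] at hα₀P
  -- the datum is a datum of the sourced core at level `m`
  have hWu : ∀ x κ, W x κ ∈ unitaryUnits 𝔸 := mem_unitaryUnits_of_mgauge_eq hU₀ hU' hu hW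
  have hInAm : InAk L m (ι a).η α₀ (ι a).Ω U₀ := fun j hj => hInA j (hj.trans hmk)
  have hlog : ∀ (x : Site d) (μ : Fin d), BondTouches ((ι a).Ω 0) x μ → logCfg (ι a).η W x μ = A' x μ :=
    fun x μ _ => B9SupplySockB9P3ZdSrc.logCfg_eq_of_univ L hd2 hη (hΩJ a) U₀ hWu hK16 h41 x μ
  have hcl : ∃ μ : ℕ → Site d → 𝔸, ∀ x ∈ (ι a).Ω 0,
      covLap (ι a).η U₀ (((ι a).Ω 0).indicator (covDivB (ι a).η U₀ A' - φ)) x = QT L m ((ι a).Λs m) U₀ μ x :=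
    (B9SupplySockB9P3ZdSrc.mulClause_congr φ hlog).1 hLanF.1
  obtain ⟨r1, r2, -, -, -⟩ := sockSrc_core_at_univ_per (p a) L (ops a) hL hM1 (ι a) (hΩJ a) (hinv a m hmk) (hcurv a m hmk) (ΛbP a)
    (havg a m hmk) (hglob a m hmk) (hhol a m hmk) (hper a m hmk) (hDRDs a m hmk) (hadd a m hmk) (hsrc a m hmk) (hsrcH a m hmk) hc69 hq hB₀ hcS hcSβ
    α₀ K hα₀ hα₀P hKpos hK16 U₀ hU₀ hU₀p hInAm A' hsa hA'p (fun j hj y τ hs' => (h41 j hj y τ hs').2) hA0 φ hφp hφs hφB hcl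
  rw [← hB'_def] at r1 r2
  obtain ⟨F, hF_def⟩ : ∃ F : ℝ, F = msup L (ι a).k (ι a).η (-(2 : ℝ)) (fun j (x : Site d) => x ∈ (ι a).Ω j) φ := ⟨_, rfl⟩
  rw [← hF_def] at r1 r2 hφF
  have hS : 2 * (cS * F) ≤ 2 * cS * γ / B' * B' * (α₀ + α₁) := by
    have h1 : cS * F ≤ cS * (γ * (α₀ + α₁)) := mul_le_mul_of_nonneg_left hφF.le hcS
    have h2 : 2 * cS * γ / B' * B' * (α₀ + α₁) = 2 * (cS * (γ * (α₀ + α₁))) := by field_simp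
    linarith
  exact ⟨r1.trans (by linarith), r2.trans (by linarith)⟩

end Family

/-! ## §2  For the genuine torus record: the structural binders discharged; print's class -/

section Genuine

variable (L : ℕ) (τ : 𝔸 →ₗ[ℂ] ℂ) [Nontrivial 𝔸] [FiniteDimensional ℝ 𝔸]

/-- ★★★ **T5's `SH59src` FOR THE GENUINE TORUS RECORD `opsAllZdPer τ L (p a) (ΛbP a) ops₀` FROM THE FIVE ANALYTIC BINDERS AT EVERY TRUNCATION** — `2 ≤ d`, `2 ≤ L`,
`1 ≤ M`, faithful Hermitian tracial `τ` with `C_τ`, `Lᵏ ∣ p a` (so `Lᵐ ∣ p a` for `m ≤ k`), periodic class sections and EDITION P₀'s law `LevelSepPP0 L m (ι a).Ω (ΛbP a) s`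
at every truncation; `CurvAtInAk` (c₆₉ = 14(d−1)), `AvgAtP` (q = qQ d L C_τ β_τ s), `PerAtU`, `PerDRDsAt`, `GopAddAt` DISCHARGED (g22 ∕ FILE 5).
[cite: Balaban1985RegularSpaces, Thm 4 p.88, Thm 8 + (1.146) p.101, (1.57)–(1.59) p.86, (1.31) p.82, p.77; Balaban1985BackgroundPropagators, Thm 3.3 p.399, (3.42) p.397, (3.43)–(3.47) p.398, (3.27) p.395, Thm 3.11 p.416, (3.69) p.404, (3.16) p.393] -/
theorem sockH59srcPer_opsAllZdPer_of_binders (hd2 : 2 ≤ d) (hL : 2 ≤ L) (hτp : ∀ a : 𝔸, a ≠ 0 → 0 < (τ (star a * a)).re)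
    (hτt : ∀ a b : 𝔸, τ (a * b) = τ (b * a)) (hτs : ∀ a : 𝔸, τ (star a) = starRingEnd ℂ (τ a))
    {Cτ : ℝ} (hCτ : ∀ x y : 𝔸, |(τ (star x * y)).re| ≤ Cτ * ‖x‖ * ‖y‖)
    (ops₀ : ℝ → ZdIdx d L → ℕ → OpsZd d 𝔸) {M : ℝ} (hM1 : 1 ≤ M)
    {J : Type*} (ι : J → ZdIdx d L) (p : J → ℕ) (hp : ∀ a, NeZero (p a)) (hΩJ : ∀ a, (ι a).Ω 0 = Set.univ) (ΛbP : J → ℕ → ℕ → Set (Site d × Fin d)) {s : ℕ}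
    (hdvd : ∀ a, L ^ (ι a).k ∣ p a)
    (hΛ : ∀ a m, m ≤ (ι a).k → ∀ j, j ≤ m → ∀ κ : Fin d, IsPeriodic (p a / L ^ j) (fun z => (z, κ) ∈ ΛbP a m j))
    (hlaw : ∀ a m, m ≤ (ι a).k → LevelSepPP0 L m (ι a).Ω (ΛbP a) s)
    {aI aT aS B₀ Cβ β cS cSβ : ℝ} {len : Site d → ℝ}
    (hinv : ∀ a m, m ≤ (ι a).k → InvAtHIPer (p a) L (opsAllZdPer τ L (p a) (ΛbP a) ops₀) aI M (ι a) m)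
    (hglob : ∀ a m, m ≤ (ι a).k → GlobAtIPer (p a) L (opsAllZdPer τ L (p a) (ΛbP a) ops₀) aT B₀ M (ι a) m)
    (hhol : ∀ a m, m ≤ (ι a).k → HolderAtIH2Per (p a) L (opsAllZdPer τ L (p a) (ΛbP a) ops₀) aT Cβ β len M (ι a) m)
    (hsrc : ∀ a m, m ≤ (ι a).k → SrcAtIPer (p a) L (opsAllZdPer τ L (p a) (ΛbP a) ops₀) aS cS M (ι a) m)
    (hsrcH : ∀ a m, m ≤ (ι a).k → SrcHolderAtIH2Per (p a) L (opsAllZdPer τ L (p a) (ΛbP a) ops₀) aS cSβ β len M (ι a) m)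
    (hB₀ : 0 < B₀) (hcS : 0 ≤ cS) (hcSβ : 0 ≤ cSβ) (γ : ℝ) {B₈ B₀'' : ℝ} (hB₈ : 0 < B₈) (hB₀'' : 0 ≤ B₀'') :
    ∀ a : J, ∀ α₀ α₁ : ℝ, 0 < α₀ → 0 < α₁ → α₀ + α₁ ≤ min (min (1 / 16) (min aI (min aT (min aS (1 / (2 * B₀ * (14 * ((d - 1 : ℕ) : ℝ)) * M + 1)))))) ((min (1 / 16) (min aI (min aT (min aS (1 / (2 * B₀ * (14 * ((d - 1 : ℕ) : ℝ)) * M + 1)))))) / (2 * (L * (5 * (d : ℝ) * L * B₈)) + 8 * (8 * B₀'' * (5 * (d : ℝ) * L * B₈)))) →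
      ∀ U₀ U' : Site d → Fin d → 𝔸ˣ, (∀ x κ, U₀ x κ ∈ unitaryUnits 𝔸) → (∀ x κ, U' x κ ∈ unitaryUnits 𝔸) →
      IsPeriodic (p a) U₀ → IsPeriodic (p a) U' → ∀ φ : Site d → 𝔸, (((InR138 L (ι a).k (ι a).η ((ι a).Ω 0) ((ι a).Λs (ι a).k) U₀ φ ∧ (∀ x, IsSelfAdjoint (φ x)) ∧ (∀ x, x ∉ (ι a).Ω 0 → φ x = 0) ∧
          Bdd L (ι a).k (ι a).η (-(2 : ℝ)) (fun j (x : Site d) => x ∈ (ι a).Ω j) φ) ∧ IsPeriodic (p a) φ) ∧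
        msup L (ι a).k (ι a).η (-(2 : ℝ)) (fun j (x : Site d) => x ∈ (ι a).Ω j) φ < γ * (α₀ + α₁)) →
      InAk L (ι a).k (ι a).η α₀ (ι a).Ω U₀ → InAk L (ι a).k (ι a).η α₀ (ι a).Ω (mulCfg U' U₀) → (∀ m, m ≤ (ι a).k → InAx L m ((ι a).Λs m) U₀ (mulCfg U' U₀)) →
      (∀ j, j ≤ (ι a).k → ∀ (z : Site d) (μ : Fin d),
        ((∀ x, InBox (tlo L z j) (thi L z j) x → x ∈ (ι a).Ω j) ∨ (∀ x, InBox (tlo L (z + e μ) j) (thi L (z + e μ) j) x → x ∈ (ι a).Ω j)) →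
        ‖(avgIter L (mulCfg U' U₀) j z μ : 𝔸) - (avgIter L U₀ j z μ : 𝔸)‖ ≤ α₁) →
      (∀ b ∈ {b : Site d × Fin d | SideTouches ((ι a).Ω 0) b.1 b.2}, ‖((U' b.1 b.2 : 𝔸ˣ) : 𝔸) - 1‖ ≤ α₁) →
      (∀ m, 1 ≤ m → m ≤ (ι a).k → ∀ (u : Site d → 𝔸ˣ) (W : Site d → Fin d → 𝔸ˣ) (A' : Site d → Fin d → 𝔸),
        (∀ x, u x ∈ unitaryUnits 𝔸) → IsPeriodic (p a) u → IsPeriodic (p a) W → IsPeriodic (p a) A' →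
        mgauge U₀ u W = U' → Restr129 L m ((ι a).Λs m) U₀ u → LanF146 L (ι a).k (ι a).η ((ι a).Ω 0) (ι a).Λs U₀ φ m W →
        (∀ y τ, IsSelfAdjoint (A' y τ)) →
        (∀ j, j ≤ m → ∀ y τ, SideTouches ((ι a).Ω j) y τ →
        W y τ = cfgExp (ι a).η A' y τ ∧ ‖A' y τ‖ ≤ (2 * (L * (5 * (d : ℝ) * L * B₈ * (α₀ + α₁))) + 8 * (8 * B₀'' * (5 * (d : ℝ) * L * B₈) * (α₀ + α₁))) * ((L : ℝ) ^ j * (ι a).η)⁻¹) →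
        (∀ y τ, (∀ j, j ≤ m → ¬ SideTouches ((ι a).Ω j) y τ) → A' y τ = 0) →
        msup L m (ι a).η (-(1 : ℝ)) (fun j (b : Site d × Fin d) => SideTouches ((ι a).Ω j) b.1 b.2) (fun b => A' b.1 b.2)
        ≤ max 1 (2 * B₀ * max 1 (qQ d L Cτ (betaTau τ) s)) * (bondNorm L m (ι a).η (-(3 : ℝ)) (ι a).Ω (fun x μ => Jcur (ι a).η U₀ A' μ x)
        + wsup 1 (fun p : {p : ℕ × (Site d × Fin d) // p.1 ≤ m ∧ p.2 ∈ ΛbP a m p.1} =>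
        linCovIter L U₀ (iEta (ι a).η A') p.1.1 p.1.2.1 p.1.2.2)) + (2 * cS * γ / max 1 (2 * B₀ * max 1 (qQ d L Cτ (betaTau τ) s))) * max 1 (2 * B₀ * max 1 (qQ d L Cτ (betaTau τ) s)) * (α₀ + α₁) ∧
        msup L m (ι a).η (-(2 : ℝ)) (fun j (t : Fin d × Fin d × Site d) => SideTouches ((ι a).Ω j) t.2.2 t.2.1)
        (fun t => covDerivFwd (ι a).η U₀ t.1 (fun z => A' z t.2.1) t.2.2)
        ≤ max 1 (2 * B₀ * max 1 (qQ d L Cτ (betaTau τ) s)) * (bondNorm L m (ι a).η (-(3 : ℝ)) (ι a).Ω (fun x μ => Jcur (ι a).η U₀ A' μ x)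
        + wsup 1 (fun p : {p : ℕ × (Site d × Fin d) // p.1 ≤ m ∧ p.2 ∈ ΛbP a m p.1} =>
        linCovIter L U₀ (iEta (ι a).η A') p.1.1 p.1.2.1 p.1.2.2)) + (2 * cS * γ / max 1 (2 * B₀ * max 1 (qQ d L Cτ (betaTau τ) s))) * max 1 (2 * B₀ * max 1 (qQ d L Cτ (betaTau τ) s)) * (α₀ + α₁)) := by
  have hL1 : 1 ≤ L := le_trans (by norm_num) hL
  have hq : 0 ≤ qQ d L Cτ (betaTau τ) s := by
    have hCτ0 : 0 ≤ Cτ := by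
      have h := hCτ 1 1
      rw [star_one, one_mul, norm_one, mul_one, mul_one] at h
      exact le_trans (abs_nonneg _) h
    have hβ : 0 ≤ betaTau τ := by
      unfold betaTau
      split_ifs
      · exact Finset.sum_nonneg fun i _ => mul_nonneg (norm_nonneg _) (norm_nonneg _)
      · exact le_rfl
    have hα : 0 ≤ B9Eq316AveragingTransposeZd.alphaQ d L := (B9Eq316AveragingTransposeZd.alphaQ_pos d hL1).le
    have hθ : 0 ≤ B7Prop5GeneralLevels.thetaGen d L (B9Eq316AveragingTransposeZd.alphaQ d L) := by
      unfold B7Prop5GeneralLevels.thetaGen; positivity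
    unfold qQ; positivity
  haveI : NeZero L := ⟨by omega⟩
  have hbox : ∀ a m, m ≤ (ι a).k → ∀ j, 1 ≤ j → j ≤ m → ∀ c ∈ ΛbP a m j, ∀ x, InBox (loK L j c.1) (bondHiK L j c.1 c.2) x → x ∈ (ι a).Ω (j - 1) :=
    fun a m hm j hj1 hj c hc x hx => (hlaw a m hm j hj c hc x hx).1 hj1
  refine sockH59srcPer_of_binders L hd2 hL1 hM1 ι p hp hΩJ (fun a => opsAllZdPer τ L (p a) (ΛbP a) ops₀) ΛbP hinv
    (fun a m _ => curvAtInAk_opsAllZdPer L τ (p a) hL1 (ΛbP a) ops₀ hM1 (ι a) m)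
    (fun a m hm => avgAtP_opsAllZdPer₀ L τ (p a) hd2 hL hCτ (ΛbP a) ops₀ M (ι a) m (hlaw a m hm)) hglob hhol
    (fun a m hm => ?_) (fun a m _ => ?_) (fun a m _ => ?_) hsrc hsrcH (by positivity) hq hB₀ hcS hcSβ γ hB₈ hB₀''
  · haveI := hp a
    exact perAtU_opsAllZdPer L τ (p a) hL hτp hτt hτs (ΛbP a) ops₀ M (ι a) ((pow_dvd_pow L hm).trans (hdvd a)) (hΛ a m hm) (hbox a m hm)
  · haveI := hp a
    exact perDRDsAt_opsAllZdPer L τ (p a) hτs hτp (ΛbP a) ops₀ M (ι a) m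
  · exact gopAddAt_opsAllZdPer τ L (p a) (ΛbP a) ops₀ M (ι a) m

/-- ★★★ **T5's `SH59src` FOR THE GENUINE TORUS RECORD WITH PRINT'S CLASS (1.31) — dag-n05-c T5's hypothesis LITERALLY** (`|B₁|` over
`towerBondsP L (ι a).Ω ((ι a).Λs m) p.1` at every truncation `m`): §2 at `ΛbP a := fun k j => towerBondsP L (ι a).Ω ((ι a).Λs k) j`.
[cite: Balaban1985RegularSpaces, Thm 4 p.88, Thm 8 + (1.146) p.101, (1.57)–(1.59) p.86, (1.31) p.82, p.77 («Ω_j = T_η»); Balaban1985BackgroundPropagators, Thm 3.3 p.399, (3.42) p.397, (3.43)–(3.47) p.398, Thm 3.11 p.416; Balaban1984PropagatorsII, (2.3) p.224] -/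
theorem sockH59srcPer_opsAllZdPer_towerBondsP (hd2 : 2 ≤ d) (hL : 2 ≤ L) (hτp : ∀ a : 𝔸, a ≠ 0 → 0 < (τ (star a * a)).re)
    (hτt : ∀ a b : 𝔸, τ (a * b) = τ (b * a)) (hτs : ∀ a : 𝔸, τ (star a) = starRingEnd ℂ (τ a))
    {Cτ : ℝ} (hCτ : ∀ x y : 𝔸, |(τ (star x * y)).re| ≤ Cτ * ‖x‖ * ‖y‖)
    (ops₀ : ℝ → ZdIdx d L → ℕ → OpsZd d 𝔸) {M : ℝ} (hM1 : 1 ≤ M)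
    {J : Type*} (ι : J → ZdIdx d L) (p : J → ℕ) (hp : ∀ a, NeZero (p a)) (hΩJ : ∀ a, (ι a).Ω 0 = Set.univ) {s : ℕ}
    (hdvd : ∀ a, L ^ (ι a).k ∣ p a)
    (hΛ : ∀ a m, m ≤ (ι a).k → ∀ j, j ≤ m → ∀ κ : Fin d, IsPeriodic (p a / L ^ j) (fun z => (z, κ) ∈ towerBondsP L (ι a).Ω ((ι a).Λs m) j))
    (hlaw : ∀ a m, m ≤ (ι a).k → LevelSepPP0 L m (ι a).Ω (fun k j => towerBondsP L (ι a).Ω ((ι a).Λs k) j) s)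
    {aI aT aS B₀ Cβ β cS cSβ : ℝ} {len : Site d → ℝ}
    (hinv : ∀ a m, m ≤ (ι a).k → InvAtHIPer (p a) L (opsAllZdPer τ L (p a) (fun k j => towerBondsP L (ι a).Ω ((ι a).Λs k) j) ops₀) aI M (ι a) m)
    (hglob : ∀ a m, m ≤ (ι a).k → GlobAtIPer (p a) L (opsAllZdPer τ L (p a) (fun k j => towerBondsP L (ι a).Ω ((ι a).Λs k) j) ops₀) aT B₀ M (ι a) m)
    (hhol : ∀ a m, m ≤ (ι a).k → HolderAtIH2Per (p a) L (opsAllZdPer τ L (p a) (fun k j => towerBondsP L (ι a).Ω ((ι a).Λs k) j) ops₀) aT Cβ β len M (ι a) m)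
    (hsrc : ∀ a m, m ≤ (ι a).k → SrcAtIPer (p a) L (opsAllZdPer τ L (p a) (fun k j => towerBondsP L (ι a).Ω ((ι a).Λs k) j) ops₀) aS cS M (ι a) m)
    (hsrcH : ∀ a m, m ≤ (ι a).k →
      SrcHolderAtIH2Per (p a) L (opsAllZdPer τ L (p a) (fun k j => towerBondsP L (ι a).Ω ((ι a).Λs k) j) ops₀) aS cSβ β len M (ι a) m)
    (hB₀ : 0 < B₀) (hcS : 0 ≤ cS) (hcSβ : 0 ≤ cSβ) (γ : ℝ) {B₈ B₀'' : ℝ} (hB₈ : 0 < B₈) (hB₀'' : 0 ≤ B₀'') :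
    ∀ a : J, ∀ α₀ α₁ : ℝ, 0 < α₀ → 0 < α₁ → α₀ + α₁ ≤ min (min (1 / 16) (min aI (min aT (min aS (1 / (2 * B₀ * (14 * ((d - 1 : ℕ) : ℝ)) * M + 1)))))) ((min (1 / 16) (min aI (min aT (min aS (1 / (2 * B₀ * (14 * ((d - 1 : ℕ) : ℝ)) * M + 1)))))) / (2 * (L * (5 * (d : ℝ) * L * B₈)) + 8 * (8 * B₀'' * (5 * (d : ℝ) * L * B₈)))) →
      ∀ U₀ U' : Site d → Fin d → 𝔸ˣ, (∀ x κ, U₀ x κ ∈ unitaryUnits 𝔸) → (∀ x κ, U' x κ ∈ unitaryUnits 𝔸) →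
      IsPeriodic (p a) U₀ → IsPeriodic (p a) U' → ∀ φ : Site d → 𝔸, (((InR138 L (ι a).k (ι a).η ((ι a).Ω 0) ((ι a).Λs (ι a).k) U₀ φ ∧ (∀ x, IsSelfAdjoint (φ x)) ∧ (∀ x, x ∉ (ι a).Ω 0 → φ x = 0) ∧
          Bdd L (ι a).k (ι a).η (-(2 : ℝ)) (fun j (x : Site d) => x ∈ (ι a).Ω j) φ) ∧ IsPeriodic (p a) φ) ∧
        msup L (ι a).k (ι a).η (-(2 : ℝ)) (fun j (x : Site d) => x ∈ (ι a).Ω j) φ < γ * (α₀ + α₁)) →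
      InAk L (ι a).k (ι a).η α₀ (ι a).Ω U₀ → InAk L (ι a).k (ι a).η α₀ (ι a).Ω (mulCfg U' U₀) → (∀ m, m ≤ (ι a).k → InAx L m ((ι a).Λs m) U₀ (mulCfg U' U₀)) →
      (∀ j, j ≤ (ι a).k → ∀ (z : Site d) (μ : Fin d),
        ((∀ x, InBox (tlo L z j) (thi L z j) x → x ∈ (ι a).Ω j) ∨ (∀ x, InBox (tlo L (z + e μ) j) (thi L (z + e μ) j) x → x ∈ (ι a).Ω j)) →
        ‖(avgIter L (mulCfg U' U₀) j z μ : 𝔸) - (avgIter L U₀ j z μ : 𝔸)‖ ≤ α₁) →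
      (∀ b ∈ {b : Site d × Fin d | SideTouches ((ι a).Ω 0) b.1 b.2}, ‖((U' b.1 b.2 : 𝔸ˣ) : 𝔸) - 1‖ ≤ α₁) →
      (∀ m, 1 ≤ m → m ≤ (ι a).k → ∀ (u : Site d → 𝔸ˣ) (W : Site d → Fin d → 𝔸ˣ) (A' : Site d → Fin d → 𝔸),
        (∀ x, u x ∈ unitaryUnits 𝔸) → IsPeriodic (p a) u → IsPeriodic (p a) W → IsPeriodic (p a) A' →
        mgauge U₀ u W = U' → Restr129 L m ((ι a).Λs m) U₀ u → LanF146 L (ι a).k (ι a).η ((ι a).Ω 0) (ι a).Λs U₀ φ m W →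
        (∀ y τ, IsSelfAdjoint (A' y τ)) →
        (∀ j, j ≤ m → ∀ y τ, SideTouches ((ι a).Ω j) y τ →
        W y τ = cfgExp (ι a).η A' y τ ∧ ‖A' y τ‖ ≤ (2 * (L * (5 * (d : ℝ) * L * B₈ * (α₀ + α₁))) + 8 * (8 * B₀'' * (5 * (d : ℝ) * L * B₈) * (α₀ + α₁))) * ((L : ℝ) ^ j * (ι a).η)⁻¹) →
        (∀ y τ, (∀ j, j ≤ m → ¬ SideTouches ((ι a).Ω j) y τ) → A' y τ = 0) →
        msup L m (ι a).η (-(1 : ℝ)) (fun j (b : Site d × Fin d) => SideTouches ((ι a).Ω j) b.1 b.2) (fun b => A' b.1 b.2)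
        ≤ max 1 (2 * B₀ * max 1 (qQ d L Cτ (betaTau τ) s)) * (bondNorm L m (ι a).η (-(3 : ℝ)) (ι a).Ω (fun x μ => Jcur (ι a).η U₀ A' μ x)
        + wsup 1 (fun p : {p : ℕ × (Site d × Fin d) // p.1 ≤ m ∧ p.2 ∈ towerBondsP L (ι a).Ω ((ι a).Λs m) p.1} =>
        linCovIter L U₀ (iEta (ι a).η A') p.1.1 p.1.2.1 p.1.2.2)) + (2 * cS * γ / max 1 (2 * B₀ * max 1 (qQ d L Cτ (betaTau τ) s))) * max 1 (2 * B₀ * max 1 (qQ d L Cτ (betaTau τ) s)) * (α₀ + α₁) ∧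
        msup L m (ι a).η (-(2 : ℝ)) (fun j (t : Fin d × Fin d × Site d) => SideTouches ((ι a).Ω j) t.2.2 t.2.1)
        (fun t => covDerivFwd (ι a).η U₀ t.1 (fun z => A' z t.2.1) t.2.2)
        ≤ max 1 (2 * B₀ * max 1 (qQ d L Cτ (betaTau τ) s)) * (bondNorm L m (ι a).η (-(3 : ℝ)) (ι a).Ω (fun x μ => Jcur (ι a).η U₀ A' μ x)
        + wsup 1 (fun p : {p : ℕ × (Site d × Fin d) // p.1 ≤ m ∧ p.2 ∈ towerBondsP L (ι a).Ω ((ι a).Λs m) p.1} =>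
        linCovIter L U₀ (iEta (ι a).η A') p.1.1 p.1.2.1 p.1.2.2)) + (2 * cS * γ / max 1 (2 * B₀ * max 1 (qQ d L Cτ (betaTau τ) s))) * max 1 (2 * B₀ * max 1 (qQ d L Cτ (betaTau τ) s)) * (α₀ + α₁)) :=
  sockH59srcPer_opsAllZdPer_of_binders L τ hd2 hL hτp hτt hτs hCτ ops₀ hM1 ι p hp hΩJ (fun a k j => towerBondsP L (ι a).Ω ((ι a).Λs k) j)
    hdvd hΛ hlaw hinv hglob hhol hsrc hsrcH hB₀ hcS hcSβ γ hB₈ hB₀''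

end Genuine

/-! ## §3  At the torus member: ONE constant set for all truncations, and T5's `SH59src` fully fed -/

section Torus

variable [FiniteDimensional ℝ 𝔸] [Nontrivial 𝔸] (τ : 𝔸 →ₗ[ℂ] ℂ) (hτp : ∀ a : 𝔸, a ≠ 0 → 0 < (τ (star a * a)).re)
  (hτt : ∀ a b : 𝔸, τ (a * b) = τ (b * a)) (hτs : ∀ a : 𝔸, τ (star a) = starRingEnd ℂ (τ a)) {L P : ℕ} [NeZero P] [NeZero L]

include hτp hτt hτs in
/-- ★★★ **THE FIVE ANALYTIC BINDERS AT THE TORUS MEMBER, ONE TRUNCATION, FREE CONSTANTS** (FILE 6's `srcBinders_opsAllZdPer_torusIdx` with the explicit constants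
forgotten): `∃ aI aT B₀ > 0, C_β c_S c_Sβ ≥ 0` with `InvAtHIPer aI`, `GlobAtIPer aT B₀`, `HolderAtIH2Per aT C_β`, `SrcAtIPer aT c_S`, `SrcHolderAtIH2Per aT c_Sβ` at `m`, `Lᵐ ∣ P`.
[cite: Balaban1985BackgroundPropagators, Thm 3.11 p.416, Thm 3.3 p.399, (3.42) p.397, (3.43)–(3.47) p.398; Balaban1985RegularSpaces, (1.58)–(1.59) p.86, p.77 («Ω_j = T_η»)] -/
theorem srcBinders_opsAllZdPer_torusIdx_exists (hd2 : 2 ≤ d) (hL2 : 2 ≤ L) {Cτ : ℝ} (hCτ : ∀ x y : 𝔸, |(τ (star x * y)).re| ≤ Cτ * ‖x‖ * ‖y‖)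
    (t : TorusMember) (ops₀ : ℝ → ZdIdx d L → ℕ → OpsZd d 𝔸) (M : ℝ) (m : ℕ) (hP : L ^ m ∣ P)
    {β : ℝ} (hβ : 0 ≤ β) {len : Site d → ℝ} (hlen : ∀ v : Site d, 0 < len v → 1 ≤ len v) :
    ∃ aI : ℝ, 0 < aI ∧ ∃ aT : ℝ, 0 < aT ∧ ∃ B₀ : ℝ, 0 < B₀ ∧ ∃ Cβ : ℝ, 0 ≤ Cβ ∧ ∃ cS : ℝ, 0 ≤ cS ∧ ∃ cSβ : ℝ, 0 ≤ cSβ ∧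
      InvAtHIPer P L (opsAllZdPer τ L P (fun m => torusLamb m) ops₀) aI M (torusIdx (d := d) (le_trans (by norm_num) hL2) t) m ∧ GlobAtIPer P L (opsAllZdPer τ L P (fun m => torusLamb m) ops₀) aT B₀ M (torusIdx (d := d) (le_trans (by norm_num) hL2) t) m ∧ HolderAtIH2Per P L (opsAllZdPer τ L P (fun m => torusLamb m) ops₀) aT Cβ β len M (torusIdx (d := d) (le_trans (by norm_num) hL2) t) m ∧
      SrcAtIPer P L (opsAllZdPer τ L P (fun m => torusLamb m) ops₀) aT cS M (torusIdx (d := d) (le_trans (by norm_num) hL2) t) m ∧ SrcHolderAtIH2Per P L (opsAllZdPer τ L P (fun m => torusLamb m) ops₀) aT cSβ β len M (torusIdx (d := d) (le_trans (by norm_num) hL2) t) m := by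
  obtain ⟨aI, haI, aT, haT, B₀, hB₀, K, hK1, hinv, hglob, hhol, hsrc, hsrcH⟩ :=
    srcBinders_opsAllZdPer_torusIdx τ hτp hτt hτs hd2 hL2 hCτ t ops₀ M m hP hβ hlen
  have hK0 : 0 ≤ K := zero_le_one.trans hK1
  have hrp : 0 ≤ ((L : ℝ) ^ m) ^ β := Real.rpow_nonneg (by positivity) β
  exact ⟨aI, haI, aT, haT, B₀, hB₀, 2 * B₀ * (((L : ℝ) ^ m) ^ β), by positivity, B₀ * (2 * K * ((L : ℝ) ^ m) ^ 3), by positivity,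
    2 * B₀ * (((L : ℝ) ^ m) ^ β) * (2 * K * ((L : ℝ) ^ m) ^ 3), by positivity, hinv, hglob, hhol, hsrc, hsrcH⟩

include hτp hτt hτs in
/-- ★★★★ **ONE CONSTANT SET FOR THE FIVE ANALYTIC BINDERS AT ALL TRUNCATIONS `m ≤ K` OF THE TORUS MEMBER** (`Lᴷ ∣ P`; induction on `K`, the `…_anti` monotonicity
of the five binders; constants `(t, P, τ, K)`-dependent — WATCH-QUAL-SOCKET-TORUS). [cite: Balaban1985BackgroundPropagators, Thm 3.11 p.416, Thm 3.3 p.399, (3.42) p.397, (3.43)–(3.47) p.398; Balaban1985RegularSpaces, (1.58)–(1.59) p.86, (1.5)–(1.6) p.77, p.77 («Ω_j = T_η»)] -/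
theorem srcBinders_opsAllZdPer_torusIdx_allLevels (hd2 : 2 ≤ d) (hL2 : 2 ≤ L) {Cτ : ℝ} (hCτ : ∀ x y : 𝔸, |(τ (star x * y)).re| ≤ Cτ * ‖x‖ * ‖y‖)
    (t : TorusMember) (ops₀ : ℝ → ZdIdx d L → ℕ → OpsZd d 𝔸) (M : ℝ) {K : ℕ} (hPK : L ^ K ∣ P)
    {β : ℝ} (hβ : 0 ≤ β) {len : Site d → ℝ} (hlen : ∀ v : Site d, 0 < len v → 1 ≤ len v) :
    ∃ aI : ℝ, 0 < aI ∧ ∃ aT : ℝ, 0 < aT ∧ ∃ B₀ : ℝ, 0 < B₀ ∧ ∃ Cβ : ℝ, 0 ≤ Cβ ∧ ∃ cS : ℝ, 0 ≤ cS ∧ ∃ cSβ : ℝ, 0 ≤ cSβ ∧ ∀ m, m ≤ K →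
      InvAtHIPer P L (opsAllZdPer τ L P (fun m => torusLamb m) ops₀) aI M (torusIdx (d := d) (le_trans (by norm_num) hL2) t) m ∧ GlobAtIPer P L (opsAllZdPer τ L P (fun m => torusLamb m) ops₀) aT B₀ M (torusIdx (d := d) (le_trans (by norm_num) hL2) t) m ∧ HolderAtIH2Per P L (opsAllZdPer τ L P (fun m => torusLamb m) ops₀) aT Cβ β len M (torusIdx (d := d) (le_trans (by norm_num) hL2) t) m ∧
      SrcAtIPer P L (opsAllZdPer τ L P (fun m => torusLamb m) ops₀) aT cS M (torusIdx (d := d) (le_trans (by norm_num) hL2) t) m ∧ SrcHolderAtIH2Per P L (opsAllZdPer τ L P (fun m => torusLamb m) ops₀) aT cSβ β len M (torusIdx (d := d) (le_trans (by norm_num) hL2) t) m := by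
  have h0 : L ^ 0 ∣ P := by rw [pow_zero]; exact one_dvd P
  induction K with
  | zero =>
    obtain ⟨aI, haI, aT, haT, B₀, hB₀, Cβ, hCβ, cS, hcS, cSβ, hcSβ, h⟩ :=
      srcBinders_opsAllZdPer_torusIdx_exists τ hτp hτt hτs hd2 hL2 hCτ t ops₀ M 0 h0 hβ hlen
    exact ⟨aI, haI, aT, haT, B₀, hB₀, Cβ, hCβ, cS, hcS, cSβ, hcSβ, fun m hm => by rw [Nat.le_zero.1 hm]; exact h⟩
  | succ K ih =>
    obtain ⟨aI₁, haI₁, aT₁, haT₁, B₁, hB₁, Cβ₁, hCβ₁, cS₁, hcS₁, cSβ₁, hcSβ₁, h₁⟩ := ih (dvd_trans (pow_dvd_pow L K.le_succ) hPK)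
    obtain ⟨aI₂, haI₂, aT₂, haT₂, B₂, hB₂, Cβ₂, hCβ₂, cS₂, hcS₂, cSβ₂, hcSβ₂, h₂⟩ :=
      srcBinders_opsAllZdPer_torusIdx_exists τ hτp hτt hτs hd2 hL2 hCτ t ops₀ M (K + 1) hPK hβ hlen
    refine ⟨min aI₁ aI₂, lt_min haI₁ haI₂, min aT₁ aT₂, lt_min haT₁ haT₂, max B₁ B₂, lt_max_of_lt_left hB₁, max Cβ₁ Cβ₂, le_max_of_le_left hCβ₁,
      max cS₁ cS₂, le_max_of_le_left hcS₁, max cSβ₁ cSβ₂, le_max_of_le_left hcSβ₁, fun m hm => ?_⟩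
    rcases Nat.lt_or_eq_of_le hm with hlt | rfl
    · obtain ⟨i1, i2, i3, i4, i5⟩ := h₁ m (Nat.lt_succ_iff.1 hlt)
      exact ⟨invAtHIPer_anti _ _ _ _ _ (min_le_left _ _) i1, globAtIPer_anti _ _ (min_le_left _ _) (le_max_left _ _) i2,
        holderAtIH2Per_anti _ _ (min_le_left _ _) (le_max_left _ _) i3, srcAtIPer_anti _ _ (min_le_left _ _) (le_max_left _ _) i4,
        srcHolderAtIH2Per_anti _ _ (min_le_left _ _) (le_max_left _ _) i5⟩
    · obtain ⟨i1, i2, i3, i4, i5⟩ := h₂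
      exact ⟨invAtHIPer_anti _ _ _ _ _ (min_le_right _ _) i1, globAtIPer_anti _ _ (min_le_right _ _) (le_max_right _ _) i2,
        holderAtIH2Per_anti _ _ (min_le_right _ _) (le_max_right _ _) i3, srcAtIPer_anti _ _ (min_le_right _ _) (le_max_right _ _) i4,
        srcHolderAtIH2Per_anti _ _ (min_le_right _ _) (le_max_right _ _) i5⟩

include hτp hτt hτs in
/-- ★★★★★ **dag-n05-c T5's PERIODIC SOURCED SOCKET `SH59src` FOR THE GENUINE TORUS RECORD AT THE TORUS MEMBER, FULLY FED** (`2 ≤ d`, `2 ≤ L`, `Lᵏ ∣ P` for the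
member's truncation `k = tm.k`, `1 ≤ M`, `0 ≤ β`, integer lengths, any `γ`, `B₈ > 0`, `B₀″ ≥ 0`): `∃ aI aT B₀ > 0, C_β c_S c_Sβ ≥ 0` such that T5's hypothesis text
holds for the one-member family `ι := torusIdx tm`, `p := P`, class `torusLamb`, at `(Φ, Adm, LanF)` of the module docstring — §2 on §3's one constant set for all
truncations.  NO binder of Bałaban's left; constants per torus (WATCH-QUAL-SOCKET-TORUS).
[cite: Balaban1985RegularSpaces, Thm 4 p.88, Thm 8 + (1.146) p.101, (1.57)–(1.59) p.86, p.77 («Ω_j = T_η»); Balaban1985BackgroundPropagators, Thm 3.3 p.399, (3.42) p.397, (3.43)–(3.47) p.398, Thm 3.11 p.416, (3.27) p.395] -/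
theorem sockH59srcPer_genuine_torusIdx (hd2 : 2 ≤ d) (hL2 : 2 ≤ L) {Cτ : ℝ} (hCτ : ∀ x y : 𝔸, |(τ (star x * y)).re| ≤ Cτ * ‖x‖ * ‖y‖)
    (tm : TorusMember) (ops₀ : ℝ → ZdIdx d L → ℕ → OpsZd d 𝔸) {M : ℝ} (hM1 : 1 ≤ M) (hP : L ^ tm.k ∣ P)
    {β : ℝ} (hβ : 0 ≤ β) {len : Site d → ℝ} (hlen : ∀ v : Site d, 0 < len v → 1 ≤ len v) (γ : ℝ) {B₈ B₀'' : ℝ} (hB₈ : 0 < B₈) (hB₀'' : 0 ≤ B₀'') :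
    ∃ aI : ℝ, 0 < aI ∧ ∃ aT : ℝ, 0 < aT ∧ ∃ B₀ : ℝ, 0 < B₀ ∧ ∃ Cβ : ℝ, 0 ≤ Cβ ∧ ∃ cS : ℝ, 0 ≤ cS ∧ ∃ cSβ : ℝ, 0 ≤ cSβ ∧
      ∀ α₀ α₁ : ℝ, 0 < α₀ → 0 < α₁ → α₀ + α₁ ≤ min (min (1 / 16) (min aI (min aT (min aT (1 / (2 * B₀ * (14 * ((d - 1 : ℕ) : ℝ)) * M + 1)))))) ((min (1 / 16) (min aI (min aT (min aT (1 / (2 * B₀ * (14 * ((d - 1 : ℕ) : ℝ)) * M + 1)))))) / (2 * (L * (5 * (d : ℝ) * L * B₈)) + 8 * (8 * B₀'' * (5 * (d : ℝ) * L * B₈)))) →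
        ∀ U₀ U' : Site d → Fin d → 𝔸ˣ, (∀ x κ, U₀ x κ ∈ unitaryUnits 𝔸) → (∀ x κ, U' x κ ∈ unitaryUnits 𝔸) →
        IsPeriodic P U₀ → IsPeriodic P U' → ∀ φ : Site d → 𝔸, (((InR138 L (torusIdx (d := d) (le_trans (by norm_num) hL2) tm).k (torusIdx (d := d) (le_trans (by norm_num) hL2) tm).η ((torusIdx (d := d) (le_trans (by norm_num) hL2) tm).Ω 0) ((torusIdx (d := d) (le_trans (by norm_num) hL2) tm).Λs (torusIdx (d := d) (le_trans (by norm_num) hL2) tm).k) U₀ φ ∧ (∀ x, IsSelfAdjoint (φ x)) ∧ (∀ x, x ∉ (torusIdx (d := d) (le_trans (by norm_num) hL2) tm).Ω 0 → φ x = 0) ∧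
            Bdd L (torusIdx (d := d) (le_trans (by norm_num) hL2) tm).k (torusIdx (d := d) (le_trans (by norm_num) hL2) tm).η (-(2 : ℝ)) (fun j (x : Site d) => x ∈ (torusIdx (d := d) (le_trans (by norm_num) hL2) tm).Ω j) φ) ∧ IsPeriodic P φ) ∧
          msup L (torusIdx (d := d) (le_trans (by norm_num) hL2) tm).k (torusIdx (d := d) (le_trans (by norm_num) hL2) tm).η (-(2 : ℝ)) (fun j (x : Site d) => x ∈ (torusIdx (d := d) (le_trans (by norm_num) hL2) tm).Ω j) φ < γ * (α₀ + α₁)) →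
        InAk L (torusIdx (d := d) (le_trans (by norm_num) hL2) tm).k (torusIdx (d := d) (le_trans (by norm_num) hL2) tm).η α₀ (torusIdx (d := d) (le_trans (by norm_num) hL2) tm).Ω U₀ → InAk L (torusIdx (d := d) (le_trans (by norm_num) hL2) tm).k (torusIdx (d := d) (le_trans (by norm_num) hL2) tm).η α₀ (torusIdx (d := d) (le_trans (by norm_num) hL2) tm).Ω (mulCfg U' U₀) → (∀ m, m ≤ (torusIdx (d := d) (le_trans (by norm_num) hL2) tm).k → InAx L m ((torusIdx (d := d) (le_trans (by norm_num) hL2) tm).Λs m) U₀ (mulCfg U' U₀)) →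
        (∀ j, j ≤ (torusIdx (d := d) (le_trans (by norm_num) hL2) tm).k → ∀ (z : Site d) (μ : Fin d),
          ((∀ x, InBox (tlo L z j) (thi L z j) x → x ∈ (torusIdx (d := d) (le_trans (by norm_num) hL2) tm).Ω j) ∨ (∀ x, InBox (tlo L (z + e μ) j) (thi L (z + e μ) j) x → x ∈ (torusIdx (d := d) (le_trans (by norm_num) hL2) tm).Ω j)) →
          ‖(avgIter L (mulCfg U' U₀) j z μ : 𝔸) - (avgIter L U₀ j z μ : 𝔸)‖ ≤ α₁) →
        (∀ b ∈ {b : Site d × Fin d | SideTouches ((torusIdx (d := d) (le_trans (by norm_num) hL2) tm).Ω 0) b.1 b.2}, ‖((U' b.1 b.2 : 𝔸ˣ) : 𝔸) - 1‖ ≤ α₁) →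
        (∀ m, 1 ≤ m → m ≤ (torusIdx (d := d) (le_trans (by norm_num) hL2) tm).k → ∀ (u : Site d → 𝔸ˣ) (W : Site d → Fin d → 𝔸ˣ) (A' : Site d → Fin d → 𝔸),
          (∀ x, u x ∈ unitaryUnits 𝔸) → IsPeriodic P u → IsPeriodic P W → IsPeriodic P A' →
          mgauge U₀ u W = U' → Restr129 L m ((torusIdx (d := d) (le_trans (by norm_num) hL2) tm).Λs m) U₀ u → LanF146 L (torusIdx (d := d) (le_trans (by norm_num) hL2) tm).k (torusIdx (d := d) (le_trans (by norm_num) hL2) tm).η ((torusIdx (d := d) (le_trans (by norm_num) hL2) tm).Ω 0) (torusIdx (d := d) (le_trans (by norm_num) hL2) tm).Λs U₀ φ m W →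
          (∀ y τ, IsSelfAdjoint (A' y τ)) →
          (∀ j, j ≤ m → ∀ y τ, SideTouches ((torusIdx (d := d) (le_trans (by norm_num) hL2) tm).Ω j) y τ →
          W y τ = cfgExp (torusIdx (d := d) (le_trans (by norm_num) hL2) tm).η A' y τ ∧ ‖A' y τ‖ ≤ (2 * (L * (5 * (d : ℝ) * L * B₈ * (α₀ + α₁))) + 8 * (8 * B₀'' * (5 * (d : ℝ) * L * B₈) * (α₀ + α₁))) * ((L : ℝ) ^ j * (torusIdx (d := d) (le_trans (by norm_num) hL2) tm).η)⁻¹) →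
          (∀ y τ, (∀ j, j ≤ m → ¬ SideTouches ((torusIdx (d := d) (le_trans (by norm_num) hL2) tm).Ω j) y τ) → A' y τ = 0) →
          msup L m (torusIdx (d := d) (le_trans (by norm_num) hL2) tm).η (-(1 : ℝ)) (fun j (b : Site d × Fin d) => SideTouches ((torusIdx (d := d) (le_trans (by norm_num) hL2) tm).Ω j) b.1 b.2) (fun b => A' b.1 b.2)
          ≤ max 1 (2 * B₀ * max 1 (qQ d L Cτ (betaTau τ) 0)) * (bondNorm L m (torusIdx (d := d) (le_trans (by norm_num) hL2) tm).η (-(3 : ℝ)) (torusIdx (d := d) (le_trans (by norm_num) hL2) tm).Ω (fun x μ => Jcur (torusIdx (d := d) (le_trans (by norm_num) hL2) tm).η U₀ A' μ x)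
          + wsup 1 (fun p : {p : ℕ × (Site d × Fin d) // p.1 ≤ m ∧ p.2 ∈ torusLamb m p.1} =>
          linCovIter L U₀ (iEta (torusIdx (d := d) (le_trans (by norm_num) hL2) tm).η A') p.1.1 p.1.2.1 p.1.2.2)) + (2 * cS * γ / max 1 (2 * B₀ * max 1 (qQ d L Cτ (betaTau τ) 0))) * max 1 (2 * B₀ * max 1 (qQ d L Cτ (betaTau τ) 0)) * (α₀ + α₁) ∧
          msup L m (torusIdx (d := d) (le_trans (by norm_num) hL2) tm).η (-(2 : ℝ)) (fun j (t : Fin d × Fin d × Site d) => SideTouches ((torusIdx (d := d) (le_trans (by norm_num) hL2) tm).Ω j) t.2.2 t.2.1)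
          (fun t => covDerivFwd (torusIdx (d := d) (le_trans (by norm_num) hL2) tm).η U₀ t.1 (fun z => A' z t.2.1) t.2.2)
          ≤ max 1 (2 * B₀ * max 1 (qQ d L Cτ (betaTau τ) 0)) * (bondNorm L m (torusIdx (d := d) (le_trans (by norm_num) hL2) tm).η (-(3 : ℝ)) (torusIdx (d := d) (le_trans (by norm_num) hL2) tm).Ω (fun x μ => Jcur (torusIdx (d := d) (le_trans (by norm_num) hL2) tm).η U₀ A' μ x)
          + wsup 1 (fun p : {p : ℕ × (Site d × Fin d) // p.1 ≤ m ∧ p.2 ∈ torusLamb m p.1} =>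
          linCovIter L U₀ (iEta (torusIdx (d := d) (le_trans (by norm_num) hL2) tm).η A') p.1.1 p.1.2.1 p.1.2.2)) + (2 * cS * γ / max 1 (2 * B₀ * max 1 (qQ d L Cτ (betaTau τ) 0))) * max 1 (2 * B₀ * max 1 (qQ d L Cτ (betaTau τ) 0)) * (α₀ + α₁)) := by
  have hL1 : 1 ≤ L := le_trans (by norm_num) hL2
  obtain ⟨aI, haI, aT, haT, B₀, hB₀, Cβ, hCβ, cS, hcS, cSβ, hcSβ, h⟩ :=
    srcBinders_opsAllZdPer_torusIdx_allLevels τ hτp hτt hτs hd2 hL2 hCτ tm ops₀ M (K := (torusIdx (d := d) hL1 tm).k) hP hβ hlen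
  refine ⟨aI, haI, aT, haT, B₀, hB₀, Cβ, hCβ, cS, hcS, cSβ, hcSβ, ?_⟩
  exact sockH59srcPer_opsAllZdPer_of_binders L τ hd2 hL2 hτp hτt hτs hCτ ops₀ hM1 (fun _ : Unit => torusIdx (d := d) hL1 tm) (fun _ => P)
    (fun _ => inferInstance) (fun _ => rfl) (fun _ m => torusLamb m) (fun _ => hP)
    (fun _ m _ j _ κ => B9Thm311FlatPositivityZdPer.isPeriodic_mem_torusLamb (P / L ^ j) m j κ)
    (fun _ m _ => B9Thm33GlobalBlockWitnessZdPer.levelSepPP0_torusIdx' hL1 tm m)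
    (fun _ m hm => (h m hm).1) (fun _ m hm => (h m hm).2.1) (fun _ m hm => (h m hm).2.2.1) (fun _ m hm => (h m hm).2.2.2.1)
    (fun _ m hm => (h m hm).2.2.2.2) hB₀ hcS hcSβ γ hB₈ hB₀'' ()

end Torus

end Literature.MathematicalPhysics.QuantumFieldTheory.Balaban1983to89.B9SupplySockH59ZdSrcPer
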